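import Summits.BirchSwinnertonDyer.Rank1Residual.AdditivePotMult.Exactness
import Summits.BirchSwinnertonDyer.Rank1Residual.Additive.X4RankZeroUpperBound
import HarnessLib

/-!
# X4(M)⁰ in analytic rank `0`: the relocated missing input is ONE DIVISIBILITY over `K`
# (the `p`-adic BSD defect is invariant under the quadratic descent, ANY prime `p`)

HONEST FRAMING (cell `b2b-bsdres`, run/shared/lean/b2b/bsd-rank1-residual/, verbatim in every
file): the goal of the cell is to DELETE the COMBINATION-SHAPED residual classes of the
Birch–Swinnerton-Dyer formula for ALL analytic-rank `≤ 1` elliptic curves over `ℚ` — "full BSD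
formula for every rank `≤ 1` curve in class `C`" assembled STRICTLY from published theorems — so
that the rank-`≤ 1` remainder becomes exactly the CONSTRUCTION-SHAPED classes, which are TYPED
(missing-input `Prop`s), NOT attempted. This is not "finishing BSD". Sub-cell
`b2b-bsdres-additive-p1` (CLASS-OWNERS row "X3/X4 additive — pot. multiplicative / X3♯(M)"),
generation 2; research route, no claim beyond the stated sub-classes; X4(M) REMAINS
CONSTRUCTION-SHAPED (no label moves).

"DESCEND the `p`-part … with exact control of the local terms" (the seat's brief), ONE-SIDED form.
With Milne's Weil-restriction identity (`hWR`; Literature fact `Milne1972.bsdQuotient_baseChange_quadratic`)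
and `BSD(E^{(D)},p)` for the twist, the **`p`-adic BSD defect**
`δ_p := ord_p #Ш_an − ord_p #Ш` is the SAME for `E_K/K` and for `E/ℚ` (`padicValRat_defect_eq`),
for EVERY prime `p` (no parity hypothesis: the `Ш`-orders enter (★) `shaAnOver_mul_eq` linearly and
cancel against `ord_p #Ш_an(E^{(D)}) = ord_p #Ш(E^{(D)})`). Hence each HALF of the `p`-part relocates
separately:

* `MissingLowerBoundOverAt W' p` / `MissingUpperBoundOverAt W' p` — the two halves of the typed
  over-`K` input `MissingPPartOverAt` of `Descent.lean` (`#Ш_an(W'/K)` rational with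
  `ord_p #Ш_an ≤ ord_p #Ш`, resp. `≥`); over `ℚ` they are the cell's `MissingLowerBoundAt` /
  `MissingUpperBoundAt` (`…_rat_iff`);
* `missingLowerBoundAt_iff_over`, `missingUpperBoundAt_iff_over` — given `BSD(Wd,p)`:
  lower half over `K` ⟺ lower half over `ℚ`, upper ⟺ upper (any `p`);
* `bsdp_of_classX4M_of_lowerOver_of_kim` — **on X4(M)⁰ ∩ {`r_an(E) = 0`, `p ≥ 5`, `ρ̄_{E,p}` onto,
  a modular parametrisation with `p ∤ c` (Manin), `p ∤ ∏_ℓ c_ℓ(E)`} the ENTIRE missing input is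
  `MissingLowerBoundOverAt(E_K, p)`: ONE inequality `ord_p #Ш_an(E_K/K) ≤ ord_p #Ш(E_K/K)`** — the
  UPPER half over `ℚ` being Kim 2026 Thm. 1.8 (6) at any reduction type (additive-p4's
  `X4RankZero.bsdp_of_missingLowerBoundAt`, named fact `hKim`), the twist being COVERED by Skinner
  2016 Thm. C (`hSk`). That inequality is the "Eisenstein-congruence / Skinner–Urban" direction of
  the Iwasawa main conjecture for the base-changed (Hilbert, when `K` is real) modular form over the
  quadratic field `K` at a MULTIPLICATIVE prime above `p` with `p ∣ d_K`: exactly the direction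
  X. Wan, Forum Math. Sigma 3 (2015) e18, Thm. 1.1 proves over totally real `F` — under "p is
  unramified in F" (§1.1) and good ordinary `p` (Thm. 7). So on these rows the located gap is, to
  the letter, "Wan 2015 without `p ∤ d_F`, at a multiplicative prime" (equivalently over `ℚ`:
  the Skinner–Urban divisibility on the `ω^{(p-1)/2}`-branch for the `p`-multiplicative twist
  `E^{(p*)}`; Burungale–Skinner–Tian–Wan arXiv:2409.01350 Thm. 1.21(c) ANNOUNCES that divisibility
  for `g ⊗ χ_K`, `p ∣ d_K`, when `p ∤ 6N_g` — the potentially GOOD ordinary case — not for `p ‖ N_g`).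
  Nothing is asserted; X4(M) stays typed.
-/

noncomputable section

open scoped Classical

open WeierstrassCurve Literature.NumberTheory.EllipticCurves
  Literature.NumberTheory.EllipticCurves.ModularForms
  Literature.NumberTheory.EllipticCurves.Rank1Residual
  Literature.NumberTheory.EllipticCurves.Rank1Residual.Typed

namespace Summit.BirchSwinnertonDyer.Rank1Residual.AdditivePotMult

/-! ## §1 The two halves of the over-`K` input -/

section OverK

variable {K : Type*} [Field K] [NumberField K]

/-- **Lower half of the typed over-`K` input** ("main-conjecture / Eisenstein-congruence"
direction): `#Ш_an(W'/K)` is a rational `q` with `ord_p q ≤ ord_p #Ш(W'/K)`. A predicate; nothing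
asserted. [folklore] -/
def MissingLowerBoundOverAt (W' : WeierstrassCurve K) (p : ℕ) : Prop :=
  ∃ q : ℚ, shaAnOver W' = (q : ℂ) ∧ padicValRat p q ≤ padicValNat p W'.shaOrder

/-- **Upper half of the typed over-`K` input** ("Euler-system" direction): `#Ш_an(W'/K)` is a
rational `q` with `ord_p #Ш(W'/K) ≤ ord_p q`. A predicate; nothing asserted. [folklore] -/
def MissingUpperBoundOverAt (W' : WeierstrassCurve K) (p : ℕ) : Prop :=
  ∃ q : ℚ, shaAnOver W' = (q : ℂ) ∧ (padicValNat p W'.shaOrder : ℤ) ≤ padicValRat p q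

/-- The two halves make the whole over `K` (the rational value is unique). [folklore] -/
theorem missingPPartOverAt_of_lower_of_upper (W' : WeierstrassCurve K) (p : ℕ)
    (hl : MissingLowerBoundOverAt W' p) (hu : MissingUpperBoundOverAt W' p) :
    MissingPPartOverAt W' p := by
  obtain ⟨q, hq, hle⟩ := hl
  obtain ⟨q', hq', hge⟩ := hu
  have hqq : q' = q := by exact_mod_cast hq'.symm.trans hq
  subst hqq
  exact ⟨q', hq, le_antisymm hle hge⟩

/-- The whole gives both halves over `K`. [folklore] -/
theorem lower_and_upper_of_missingPPartOverAt (W' : WeierstrassCurve K) (p : ℕ)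
    (h : MissingPPartOverAt W' p) :
    MissingLowerBoundOverAt W' p ∧ MissingUpperBoundOverAt W' p := by
  obtain ⟨q, hq, hv⟩ := h
  exact ⟨⟨q, hq, hv.le⟩, ⟨q, hq, hv.ge⟩⟩

/-- Over `ℚ` the lower half over `K` is the cell's `MissingLowerBoundAt`. [folklore] -/
theorem missingLowerBoundOverAt_rat_iff (W : WeierstrassCurve ℚ) (p : ℕ) :
    MissingLowerBoundOverAt W p ↔ MissingLowerBoundAt W p := by
  simp only [MissingLowerBoundOverAt, MissingLowerBoundAt, shaAnOver_eq_shaAn]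

/-- Over `ℚ` the upper half over `K` is the cell's `MissingUpperBoundAt`. [folklore] -/
theorem missingUpperBoundOverAt_rat_iff (W : WeierstrassCurve ℚ) (p : ℕ) :
    MissingUpperBoundOverAt W p ↔ MissingUpperBoundAt W p := by
  simp only [MissingUpperBoundOverAt, MissingUpperBoundAt, shaAnOver_eq_shaAn]

end OverK

/-! ## §2 The `p`-adic BSD defect is invariant under the quadratic descent (any `p`) -/

section Defect

variable (W : WeierstrassCurve ℚ) [W.IsElliptic] (p : ℕ) [Fact p.Prime]
  (K : Type) [Field K] [NumberField K]
  (Wd : WeierstrassCurve ℚ) [Wd.IsElliptic] (W' : WeierstrassCurve K) [W'.IsElliptic]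

omit [Fact p.Prime] in
/-- `#Ш_an(W) ≠ 0` for an elliptic `W/ℚ` (modularity `hmod`: `L^*(E,1) ≠ 0`; the BSD denominators
are positive). [folklore] -/
theorem shaAn_ne_zero (hmod : hasEntireLFunction_rat) : shaAn W ≠ 0 := by
  rw [shaAn_def]
  refine div_ne_zero (mul_ne_zero (W.leadingLCoeff_ne_zero_holds (hmod W))
    (pow_ne_zero 2 (by exact_mod_cast W.torsionOrder_pos_holds.ne'))) ?_
  exact mul_ne_zero (mul_ne_zero (by exact_mod_cast W.realPeriodRat_pos_holds.ne')
    (by exact_mod_cast W.tamagawaProduct_pos_holds.ne')) (by exact_mod_cast W.regulator_pos'.ne')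

/-- **Rationality transfers down**: with (★) and `#Ш_an(Wd)` rational, a rational value of
`#Ш_an(W'/K)` gives a rational value of `#Ш_an(W)`, namely `q'·#Ш(W)·#Ш(Wd)/(q_d·#Ш(W'))`. [folklore] -/
theorem exists_shaAn_eq_of_over (hmod : hasEntireLFunction_rat) (h2 : Module.finrank ℚ K = 2)
    (hWd : ∃ C : VariableChange ℚ, C • W.quadraticTwist (NumberField.discr K : ℚ) = Wd)
    (hW' : ∃ C : VariableChange K, C • W.baseChange K = W')
    (hshaW : W.ShaFinite) (hshaD : Wd.ShaFinite) (hshaK : W'.ShaFinite)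
    (hWR : (W'.shaOrder : ℝ) * W'.regulator * W'.bsdPeriod * (W'.tamagawaProduct : ℝ) /
        (W'.torsionOrder : ℝ) ^ 2 = W.bsdRHS * Wd.bsdRHS)
    {q' qd : ℚ} (hq' : shaAnOver W' = (q' : ℂ)) (hqd : shaAn Wd = (qd : ℂ)) :
    shaAn W = ((q' * W.shaOrder * Wd.shaOrder / (qd * W'.shaOrder) : ℚ) : ℂ) := by
  have hstar := shaAnOver_mul_eq W K Wd W' hmod h2 hWd hW' hshaW hshaD hshaK hWR
  have hsK : W'.shaOrder ≠ 0 := (W'.shaOrder_pos hshaK).ne'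
  have hqd0 : (qd : ℂ) ≠ 0 := by rw [← hqd]; exact shaAn_ne_zero Wd hmod
  have hden : (qd : ℂ) * (W'.shaOrder : ℂ) ≠ 0 := mul_ne_zero hqd0 (by exact_mod_cast hsK)
  push_cast
  rw [eq_div_iff hden, ← hqd, ← hq']
  linear_combination -hstar

/-- **Rationality transfers up**: with (★), rational values of `#Ш_an(W)` and `#Ш_an(Wd)` give the
rational value `q·q_d·#Ш(W')/(#Ш(W)·#Ш(Wd))` of `#Ш_an(W'/K)`. [folklore] -/
theorem exists_shaAnOver_eq_of_rat (hmod : hasEntireLFunction_rat) (h2 : Module.finrank ℚ K = 2)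
    (hWd : ∃ C : VariableChange ℚ, C • W.quadraticTwist (NumberField.discr K : ℚ) = Wd)
    (hW' : ∃ C : VariableChange K, C • W.baseChange K = W')
    (hshaW : W.ShaFinite) (hshaD : Wd.ShaFinite) (hshaK : W'.ShaFinite)
    (hWR : (W'.shaOrder : ℝ) * W'.regulator * W'.bsdPeriod * (W'.tamagawaProduct : ℝ) /
        (W'.torsionOrder : ℝ) ^ 2 = W.bsdRHS * Wd.bsdRHS)
    {q qd : ℚ} (hq : shaAn W = (q : ℂ)) (hqd : shaAn Wd = (qd : ℂ)) :
    shaAnOver W' = ((q * qd * W'.shaOrder / (W.shaOrder * Wd.shaOrder) : ℚ) : ℂ) := by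
  have hstar := shaAnOver_mul_eq W K Wd W' hmod h2 hWd hW' hshaW hshaD hshaK hWR
  have hsW : W.shaOrder ≠ 0 := (W.shaOrder_pos hshaW).ne'
  have hsD : Wd.shaOrder ≠ 0 := (Wd.shaOrder_pos hshaD).ne'
  have hden : (W.shaOrder : ℂ) * (Wd.shaOrder : ℂ) ≠ 0 :=
    mul_ne_zero (by exact_mod_cast hsW) (by exact_mod_cast hsD)
  push_cast
  rw [eq_div_iff hden, ← hq, ← hqd]
  linear_combination hstar

/-- **The `p`-adic BSD defect is invariant under the quadratic descent, for EVERY prime `p`.**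
With Milne's identity `hWR`, all three `Ш` finite and `BSD(Wd,p)` for the twist: if `#Ш_an(W) = q`
and `#Ш_an(W'/K) = q'` are rational then
`ord_p q' − ord_p #Ш(W') = ord_p q − ord_p #Ш(W)`. Proof: (★) reads `q'·#Ш(W)·#Ш(Wd) =
q·q_d·#Ш(W')` in `ℚ` with every factor non-zero, and `ord_p q_d = ord_p #Ш(Wd)` cancels. No parity
hypothesis on `p`. [folklore] -/
theorem padicValRat_defect_eq (hmod : hasEntireLFunction_rat) (h2 : Module.finrank ℚ K = 2)
    (hWd : ∃ C : VariableChange ℚ, C • W.quadraticTwist (NumberField.discr K : ℚ) = Wd)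
    (hW' : ∃ C : VariableChange K, C • W.baseChange K = W')
    (hshaW : W.ShaFinite) (hshaD : Wd.ShaFinite) (hshaK : W'.ShaFinite)
    (hWR : (W'.shaOrder : ℝ) * W'.regulator * W'.bsdPeriod * (W'.tamagawaProduct : ℝ) /
        (W'.torsionOrder : ℝ) ^ 2 = W.bsdRHS * Wd.bsdRHS)
    (hd : BSDp Wd p) {q q' : ℚ} (hq : shaAn W = (q : ℂ)) (hq' : shaAnOver W' = (q' : ℂ)) :
    padicValRat p q' - padicValNat p W'.shaOrder = padicValRat p q - padicValNat p W.shaOrder := by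
  haveI : Finite Wd.sha := hshaD
  obtain ⟨qd, hqd, hvd⟩ := missingPPartAt_of_bsdp Wd p hd
  have hstar := shaAnOver_mul_eq W K Wd W' hmod h2 hWd hW' hshaW hshaD hshaK hWR
  have hsW : W.shaOrder ≠ 0 := (W.shaOrder_pos hshaW).ne'
  have hsD : Wd.shaOrder ≠ 0 := (Wd.shaOrder_pos hshaD).ne'
  have hsK : W'.shaOrder ≠ 0 := (W'.shaOrder_pos hshaK).ne'
  have hq0 : q ≠ 0 := by
    intro h0; apply shaAn_ne_zero W hmod; rw [hq, h0, Rat.cast_zero]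
  have hqd0 : qd ≠ 0 := by
    intro h0; apply shaAn_ne_zero Wd hmod; rw [hqd, h0, Rat.cast_zero]
  -- (★) in `ℚ`
  have hQ : q' * W.shaOrder * Wd.shaOrder = q * qd * W'.shaOrder := by
    have h : ((q' * W.shaOrder * Wd.shaOrder : ℚ) : ℂ) = ((q * qd * W'.shaOrder : ℚ) : ℂ) := by
      push_cast
      rw [← hq, ← hq', ← hqd]
      exact hstar
    exact_mod_cast h
  have hq'0 : q' ≠ 0 := by
    intro h0
    rw [h0, zero_mul, zero_mul] at hQ
    exact mul_ne_zero (mul_ne_zero hq0 hqd0) (by exact_mod_cast hsK : (W'.shaOrder : ℚ) ≠ 0) hQ.symm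
  have hsWq : (W.shaOrder : ℚ) ≠ 0 := by exact_mod_cast hsW
  have hsDq : (Wd.shaOrder : ℚ) ≠ 0 := by exact_mod_cast hsD
  have hsKq : (W'.shaOrder : ℚ) ≠ 0 := by exact_mod_cast hsK
  have hv := congrArg (padicValRat p) hQ
  rw [padicValRat.mul (mul_ne_zero hq'0 hsWq) hsDq, padicValRat.mul hq'0 hsWq,
    padicValRat.mul (mul_ne_zero hq0 hqd0) hsKq, padicValRat.mul hq0 hqd0, hvd,
    padicValRat.of_nat, padicValRat.of_nat, padicValRat.of_nat] at hv
  push_cast at hv ⊢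
  linarith

/-- **Lower half: over `K` ⟺ over `ℚ`** (given Milne's identity, finiteness, `BSD(Wd,p)`; any `p`).
[folklore] -/
theorem missingLowerBoundAt_iff_over (hmod : hasEntireLFunction_rat) (h2 : Module.finrank ℚ K = 2)
    (hWd : ∃ C : VariableChange ℚ, C • W.quadraticTwist (NumberField.discr K : ℚ) = Wd)
    (hW' : ∃ C : VariableChange K, C • W.baseChange K = W')
    (hshaW : W.ShaFinite) (hshaD : Wd.ShaFinite) (hshaK : W'.ShaFinite)
    (hWR : (W'.shaOrder : ℝ) * W'.regulator * W'.bsdPeriod * (W'.tamagawaProduct : ℝ) /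
        (W'.torsionOrder : ℝ) ^ 2 = W.bsdRHS * Wd.bsdRHS)
    (hd : BSDp Wd p) : MissingLowerBoundAt W p ↔ MissingLowerBoundOverAt W' p := by
  haveI : Finite Wd.sha := hshaD
  obtain ⟨qd, hqd, -⟩ := missingPPartAt_of_bsdp Wd p hd
  constructor
  · rintro ⟨q, hq, hle⟩
    have hq' := exists_shaAnOver_eq_of_rat W K Wd W' hmod h2 hWd hW' hshaW hshaD hshaK hWR hq hqd
    refine ⟨_, hq', ?_⟩
    have := padicValRat_defect_eq W p K Wd W' hmod h2 hWd hW' hshaW hshaD hshaK hWR hd hq hq'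
    linarith
  · rintro ⟨q', hq', hle⟩
    have hq := exists_shaAn_eq_of_over W K Wd W' hmod h2 hWd hW' hshaW hshaD hshaK hWR hq' hqd
    refine ⟨_, hq, ?_⟩
    have := padicValRat_defect_eq W p K Wd W' hmod h2 hWd hW' hshaW hshaD hshaK hWR hd hq hq'
    linarith

/-- **Upper half: over `K` ⟺ over `ℚ`** (given Milne's identity, finiteness, `BSD(Wd,p)`; any `p`).
[folklore] -/
theorem missingUpperBoundAt_iff_over (hmod : hasEntireLFunction_rat) (h2 : Module.finrank ℚ K = 2)
    (hWd : ∃ C : VariableChange ℚ, C • W.quadraticTwist (NumberField.discr K : ℚ) = Wd)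
    (hW' : ∃ C : VariableChange K, C • W.baseChange K = W')
    (hshaW : W.ShaFinite) (hshaD : Wd.ShaFinite) (hshaK : W'.ShaFinite)
    (hWR : (W'.shaOrder : ℝ) * W'.regulator * W'.bsdPeriod * (W'.tamagawaProduct : ℝ) /
        (W'.torsionOrder : ℝ) ^ 2 = W.bsdRHS * Wd.bsdRHS)
    (hd : BSDp Wd p) : MissingUpperBoundAt W p ↔ MissingUpperBoundOverAt W' p := by
  haveI : Finite Wd.sha := hshaD
  obtain ⟨qd, hqd, -⟩ := missingPPartAt_of_bsdp Wd p hd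
  constructor
  · rintro ⟨q, hq, hle⟩
    have hq' := exists_shaAnOver_eq_of_rat W K Wd W' hmod h2 hWd hW' hshaW hshaD hshaK hWR hq hqd
    refine ⟨_, hq', ?_⟩
    have := padicValRat_defect_eq W p K Wd W' hmod h2 hWd hW' hshaW hshaD hshaK hWR hd hq hq'
    linarith
  · rintro ⟨q', hq', hle⟩
    have hq := exists_shaAn_eq_of_over W K Wd W' hmod h2 hWd hW' hshaW hshaD hshaK hWR hq' hqd
    refine ⟨_, hq, ?_⟩
    have := padicValRat_defect_eq W p K Wd W' hmod h2 hWd hW' hshaW hshaD hshaK hWR hd hq hq'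
    linarith

end Defect

/-! ## §3 X4(M)⁰ in analytic rank `0`: one inequality over `K` -/

section ClassX4M

variable (W : WeierstrassCurve ℚ) [W.IsElliptic] [W.IsGloballyMinimal] (p : ℕ) [Fact p.Prime]
  (K : Type) [Field K] [NumberField K]
  (Wd : WeierstrassCurve ℚ) [Wd.IsElliptic] [Wd.IsGloballyMinimal]
  (W' : WeierstrassCurve K) [W'.IsElliptic] [W'.IsGloballyMinimal]

/-- **Lower half over `K` ⟹ lower half over `ℚ`, Milne discharged.** For `W/ℚ` globally minimal of
analytic rank `≤ 1`, `K` quadratic, `Wd` a globally minimal model of `W^{(d_K)}` of analytic rank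
`≤ 1` with `BSD(Wd,p)`, and `W'` a globally minimal `K`-model of `W_K`:
`MissingLowerBoundOverAt W' p → MissingLowerBoundAt W p` (Milne 1972 `hMilne`, GZK `hGZK`,
modularity `hmod`; any `p`). [folklore] -/
theorem missingLowerBoundAt_of_over (hGZK : rank_eq_analyticRank_of_analyticRank_le_one)
    (hmod : hasEntireLFunction_rat) (hMilne : Milne1972.bsdQuotient_baseChange_quadratic)
    (hr : W.analyticRank ≤ 1) (h2 : Module.finrank ℚ K = 2)
    (hWd : ∃ C : VariableChange ℚ, C • W.quadraticTwist (NumberField.discr K : ℚ) = Wd)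
    (hrd : Wd.analyticRank ≤ 1) (hW' : ∃ C : VariableChange K, C • W.baseChange K = W')
    (hd : BSDp Wd p) (hlow : MissingLowerBoundOverAt W' p) : MissingLowerBoundAt W p := by
  obtain ⟨-, hfinW⟩ := hGZK W hr
  obtain ⟨-, hfinD⟩ := hGZK Wd hrd
  obtain ⟨hshaK, hWR⟩ := hMilne W K h2 Wd hWd W' hW' hfinW hfinD
  exact (missingLowerBoundAt_iff_over W p K Wd W' hmod h2 hWd hW' hfinW hfinD hshaK hWR hd).mpr hlow

/-- **X4(M)⁰, analytic rank `0`, `p ≥ 5`, `ρ̄_{E,p}` onto, `p ∤ c_D · ∏ c_ℓ(E)`: `BSD(E,p)` from ONE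
inequality over `K`.** For `(E,p) ∈ X4(M)` with `L(E,1) ≠ 0`, `p ≥ 5`, `Surj W p`, a modular
parametrisation datum `D` of `W` with `p ∤ c_D` (Kim's Manin hypothesis, needed as `p² ∣ N`),
`p ∤ ∏_ℓ c_ℓ(W)`; a quadratic field `K` whose `p`-multiplicative twist `Wd ≅ E^{(d_K)}` has
`L(E^{(d_K)},1) ≠ 0` and (ram); and a globally minimal `K`-model `W'` of `E_K`:
**`MissingLowerBoundOverAt W' p → BSDp W p`**. Inputs: the UPPER half over `ℚ` is Kim 2026 Thm.
1.8 (6) at any reduction type (`hKim`, via additive-p4's `X4RankZero.bsdp_of_missingLowerBoundAt`);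
the twist is COVERED by Skinner 2016 Thm. C (`hSk`, `bsdp_twist_of_rankZero_ram`); Milne 1972
(`hMilne`), Gross–Zagier–Kolyvagin (`hGZK`), modularity (`hmod`) — all published, carried as
binders. The remaining inequality `ord_p #Ш_an(E_K/K) ≤ ord_p #Ш(E_K/K)` is the Skinner–Urban / Wan
direction over the quadratic field `K` at a multiplicative prime with `p ∣ d_K` — printed nowhere
(Wan 2015 needs `p ∤ d_F` and good ordinary `p`); X4(M) stays CONSTRUCTION-SHAPED.
[cite: Kim2022StructureSelmer, Thm. 1.9 (6) (PDF p. 8)] [cite: Skinner2016PacificMC, Thm. C (§1)] -/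
theorem bsdp_of_classX4M_of_lowerOver_of_kim
    (hKim : Kim2026.rankZero_padicValNat_sha_le_of_maninConstant)
    (hGZK : rank_eq_analyticRank_of_analyticRank_le_one) (hmod : hasEntireLFunction_rat)
    (hMilne : Milne1972.bsdQuotient_baseChange_quadratic)
    (hSk : Skinner2016.thmC_padicValRat_bsd_rank_zero)
    (hX : ClassX4M W p) (hp5 : 5 ≤ p) (hrW : W.analyticRank = 0) (hsurj : Surj W p)
    {N : ℕ} [NeZero N] (D : ModularParametrizationData W N) (hc : ¬ (p : ℤ) ∣ D.maninConstant)
    (htam : ¬ p ∣ W.tamagawaProduct) (h2 : Module.finrank ℚ K = 2)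
    (hWd : ∃ C : VariableChange ℚ, C • W.quadraticTwist (NumberField.discr K : ℚ) = Wd)
    (hmult : Mult Wd p) (hram : Ram Wd p) (hr0 : Wd.analyticRank = 0)
    (hW' : ∃ C : VariableChange K, C • W.baseChange K = W')
    (hlow : MissingLowerBoundOverAt W' p) : BSDp W p := by
  have hD : (NumberField.discr K : ℚ) ≠ 0 := by exact_mod_cast NumberField.discr_ne_zero K
  obtain ⟨hp2, -, hirrd⟩ := mult_irr_twist_of_classX4M hX hD hWd hmult
  have hd : BSDp Wd p := bsdp_twist_of_rankZero_ram p Wd hSk hGZK hmod hp2 hmult hirrd hram hr0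
  have hlowQ : MissingLowerBoundAt W p :=
    missingLowerBoundAt_of_over W p K Wd W' hGZK hmod hMilne (by rw [hrW]; exact zero_le_one) h2 hWd
      (by rw [hr0]; exact zero_le_one) hW' hd hlow
  exact Additive.X4RankZero.bsdp_of_missingLowerBoundAt W p hKim hGZK hmod hp5 hrW hX.1 hsurj D hc
    htam hlowQ

/-- **Conversely, on the same rows the lower half over `K` is all that can be missing**: the UPPER
half over `K` already HOLDS there (`MissingUpperBoundOverAt W' p`), by Kim's upper bound over `ℚ`
transported up (`missingUpperBoundAt_iff_over`). [cite: Kim2022StructureSelmer, Thm. 1.9 (6) (PDF p. 8)] -/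
theorem missingUpperBoundOverAt_of_classX4M_of_kim
    (hKim : Kim2026.rankZero_padicValNat_sha_le_of_maninConstant)
    (hGZK : rank_eq_analyticRank_of_analyticRank_le_one) (hmod : hasEntireLFunction_rat)
    (hMilne : Milne1972.bsdQuotient_baseChange_quadratic)
    (hSk : Skinner2016.thmC_padicValRat_bsd_rank_zero)
    (hX : ClassX4M W p) (hp5 : 5 ≤ p) (hrW : W.analyticRank = 0) (hsurj : Surj W p)
    {N : ℕ} [NeZero N] (D : ModularParametrizationData W N) (hc : ¬ (p : ℤ) ∣ D.maninConstant)
    (htam : ¬ p ∣ W.tamagawaProduct) (h2 : Module.finrank ℚ K = 2)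
    (hWd : ∃ C : VariableChange ℚ, C • W.quadraticTwist (NumberField.discr K : ℚ) = Wd)
    (hmult : Mult Wd p) (hram : Ram Wd p) (hr0 : Wd.analyticRank = 0)
    (hW' : ∃ C : VariableChange K, C • W.baseChange K = W') :
    MissingUpperBoundOverAt W' p := by
  have hD : (NumberField.discr K : ℚ) ≠ 0 := by exact_mod_cast NumberField.discr_ne_zero K
  obtain ⟨hp2, -, hirrd⟩ := mult_irr_twist_of_classX4M hX hD hWd hmult
  have hd : BSDp Wd p := bsdp_twist_of_rankZero_ram p Wd hSk hGZK hmod hp2 hmult hirrd hram hr0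
  obtain ⟨-, hfinW⟩ := hGZK W (by rw [hrW]; exact zero_le_one)
  obtain ⟨-, hfinD⟩ := hGZK Wd (by rw [hr0]; exact zero_le_one)
  obtain ⟨hshaK, hWR⟩ := hMilne W K h2 Wd hWd W' hW' hfinW hfinD
  have hup : MissingUpperBoundAt W p :=
    Additive.X4RankZero.missingUpperBoundAt W p hKim hGZK hmod hp5 hrW hX.1 hsurj D hc htam
  exact (missingUpperBoundAt_iff_over W p K Wd W' hmod h2 hWd hW' hfinW hfinD hshaK hWR hd).mp hup

end ClassX4M

end Summit.BirchSwinnertonDyer.Rank1Residual.AdditivePotMult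

end
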